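import Literature.MathematicalPhysics.KineticTheory.InfiniteChainClusteringTransfer
import HarnessLib

/-!
# Stub W2 `stub_weightedClusteringTransfer` of line `Sketch` (canonical reduction), crux
`FibreCalculus` of route `HoelderEscapeProfile` (stmt-AtomisticToContinuum-16011): the clustering
transfer with second moments

Abstract measure theory on `ChainConfig = ℤ → ℝ × ℝ` (no dynamics). The tree theorem
`exists_summable_majorant_covariance_comp_chainShift` (`InfiniteChainClusteringTransfer.lean`)
produces, under exponential ρ-mixing between half-lines (constant `C`, rate `m > 0`) and
translation invariance of a probability measure `μ`, for a box-local square-integrable `a` (sites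
in `[-R, R]`), a margin `K`, a level `Gb` and a summable locality rate `ε ≥ 0`, the explicit
majorant
`F x = max C 1 · ‖a‖₂ (Gb + ε(|x|/2)) e^{-m(|x| - (|x|/2 + K) - R)₊} + ‖a‖₂ ε(|x|/2)`
of `|Cov_μ(a, g ∘ τ_x)|`, uniformly over the measurable `g` with `‖g‖₂ ≤ Gb` admitting
`[-(n+K), n+K]`-local approximants within `ε n` in `L²(μ)`. Here the same proof is redone keeping
SECOND MOMENTS: if `Σ_n (1+n)² ε_n < ∞` then `Σ_x (1+x²) F x ≤ B (1 + Σ_n (1+n)² ε_n)` with the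
`ε`-free constant `B = max C 1 · ‖a‖₂ · Gb · S + 16 (max C 1 · ‖a‖₂ + ‖a‖₂)`,
`S = Σ_x (1+x²) e^{-m(|x| - (|x|/2 + K) - R)₊} < ∞`, using
`Σ_x (1+x²) ε(|x|/2) ≤ 16 Σ_n (1+n)² ε_n` and `e^{-(…)₊} ≤ 1`.

## Contents
* `wct_summable_natAbs`, `wct_tsum_natAbs_le` — sums over `ℤ` of sequences indexed by `|x|`;
* `wct_weighted_rate_nat`, `wct_weighted_rate_int` — `Σ_j (1+j²) ε(j/2) ≤ 8 Σ_n (1+n)² ε_n` and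
  `Σ_{x ∈ ℤ} (1+x²) ε(|x|/2) ≤ 16 Σ_n (1+n)² ε_n`;
* `wct_summable_weight_mul_gap` — `Σ_x (1+x²) e^{-m(|x| - (|x|/2 + K) - R)₊} < ∞`;
* `stub_weightedClusteringTransfer` — the registered stub, verbatim.
-/

noncomputable section

open MeasureTheory ProbabilityTheory Filter Topology Set Function

namespace Summit.AtomisticToContinuum.FouriersLaw.Theorems.FibreCalculusSketch

open Literature.MathematicalPhysics.KineticTheory.HeatConduction

/-- Summability over `ℤ` of a sequence indexed by `|x|`. [folklore] -/
theorem wct_summable_natAbs {u : ℕ → ℝ} (hu : Summable u) :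
    Summable fun x : ℤ => u x.natAbs := by
  refine Summable.of_nat_of_neg ?_ ?_
  · simpa only [Int.natAbs_natCast] using hu
  · simpa only [Int.natAbs_neg, Int.natAbs_natCast] using hu

/-- For a summable `u ≥ 0`, `Σ_{x ∈ ℤ} u |x| ≤ 2 Σ_n u n` (each `n ≥ 1` is hit twice, `0` once).
[folklore] -/
theorem wct_tsum_natAbs_le {u : ℕ → ℝ} (hu0 : ∀ n, 0 ≤ u n) (hu : Summable u) :
    ∑' x : ℤ, u x.natAbs ≤ 2 * ∑' n : ℕ, u n := by
  have h1 : Summable fun n : ℕ => u (n : ℤ).natAbs := by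
    simpa only [Int.natAbs_natCast] using hu
  have h2 : Summable fun n : ℕ => u (-(n : ℤ)).natAbs := by
    simpa only [Int.natAbs_neg, Int.natAbs_natCast] using hu
  rw [Summable.tsum_of_nat_of_neg (f := fun x : ℤ => u x.natAbs) h1 h2]
  simp only [Int.natAbs_neg, Int.natAbs_natCast, Int.natAbs_zero]
  linarith [hu0 0]

/-- `Σ_j (1+j²) ε(j/2) ≤ 8 Σ_n (1+n)² ε_n` for `ε ≥ 0`, with summability: the indices `j = 2n` and
`j = 2n+1` both map to `n`, and `1 + (2n)², 1 + (2n+1)² ≤ 4 (1+n)²`. [folklore] -/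
theorem wct_weighted_rate_nat {ε : ℕ → ℝ} (hε0 : ∀ n, 0 ≤ ε n)
    (hε : Summable fun n : ℕ => (1 + (n : ℝ)) ^ 2 * ε n) :
    Summable (fun j : ℕ => (1 + (j : ℝ) ^ 2) * ε (j / 2)) ∧
      ∑' j : ℕ, (1 + (j : ℝ) ^ 2) * ε (j / 2) ≤ 8 * ∑' n : ℕ, (1 + (n : ℝ)) ^ 2 * ε n := by
  have h4 : Summable fun n : ℕ => 4 * ((1 + (n : ℝ)) ^ 2 * ε n) := hε.mul_left 4
  have hev_eq : ∀ k : ℕ, 2 * k / 2 = k := fun k => by omega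
  have hod_eq : ∀ k : ℕ, (2 * k + 1) / 2 = k := fun k => by omega
  have hev_le : ∀ k : ℕ,
      (1 + ((2 * k : ℕ) : ℝ) ^ 2) * ε (2 * k / 2) ≤ 4 * ((1 + (k : ℝ)) ^ 2 * ε k) := by
    intro k
    rw [hev_eq, ← mul_assoc]
    refine mul_le_mul_of_nonneg_right ?_ (hε0 k)
    have hk : (0 : ℝ) ≤ k := Nat.cast_nonneg k
    push_cast
    nlinarith [hk]
  have hod_le : ∀ k : ℕ,
      (1 + ((2 * k + 1 : ℕ) : ℝ) ^ 2) * ε ((2 * k + 1) / 2) ≤ 4 * ((1 + (k : ℝ)) ^ 2 * ε k) := by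
    intro k
    rw [hod_eq, ← mul_assoc]
    refine mul_le_mul_of_nonneg_right ?_ (hε0 k)
    have hk : (0 : ℝ) ≤ k := Nat.cast_nonneg k
    push_cast
    nlinarith [hk]
  have hev_s : Summable fun k : ℕ => (1 + ((2 * k : ℕ) : ℝ) ^ 2) * ε (2 * k / 2) :=
    Summable.of_nonneg_of_le (fun k => mul_nonneg (by positivity) (hε0 _)) hev_le h4
  have hod_s : Summable fun k : ℕ => (1 + ((2 * k + 1 : ℕ) : ℝ) ^ 2) * ε ((2 * k + 1) / 2) :=
    Summable.of_nonneg_of_le (fun k => mul_nonneg (by positivity) (hε0 _)) hod_le h4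
  refine ⟨Summable.even_add_odd (f := fun j : ℕ => (1 + (j : ℝ) ^ 2) * ε (j / 2)) hev_s hod_s, ?_⟩
  rw [← tsum_even_add_odd (f := fun j : ℕ => (1 + (j : ℝ) ^ 2) * ε (j / 2)) hev_s hod_s]
  have h1 := hev_s.tsum_le_tsum hev_le h4
  have h2 := hod_s.tsum_le_tsum hod_le h4
  rw [tsum_mul_left] at h1 h2
  linarith

/-- `Σ_{x ∈ ℤ} (1+x²) ε(|x|/2) ≤ 16 Σ_n (1+n)² ε_n` for `ε ≥ 0`, with summability. [folklore] -/
theorem wct_weighted_rate_int {ε : ℕ → ℝ} (hε0 : ∀ n, 0 ≤ ε n)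
    (hε : Summable fun n : ℕ => (1 + (n : ℝ)) ^ 2 * ε n) :
    Summable (fun x : ℤ => (1 + (x : ℝ) ^ 2) * ε (x.natAbs / 2)) ∧
      ∑' x : ℤ, (1 + (x : ℝ) ^ 2) * ε (x.natAbs / 2) ≤ 16 * ∑' n : ℕ, (1 + (n : ℝ)) ^ 2 * ε n := by
  obtain ⟨hu, hu_le⟩ := wct_weighted_rate_nat hε0 hε
  have e : (fun x : ℤ => (1 + (x : ℝ) ^ 2) * ε (x.natAbs / 2)) =
      fun x : ℤ => (1 + ((x.natAbs : ℕ) : ℝ) ^ 2) * ε (x.natAbs / 2) := by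
    funext x
    rw [Nat.cast_natAbs, Int.cast_abs, sq_abs]
  rw [e]
  have h0 : ∀ j : ℕ, 0 ≤ (1 + (j : ℝ) ^ 2) * ε (j / 2) := fun j => mul_nonneg (by positivity) (hε0 _)
  refine ⟨wct_summable_natAbs (u := fun j : ℕ => (1 + (j : ℝ) ^ 2) * ε (j / 2)) hu, ?_⟩
  calc ∑' x : ℤ, (1 + ((x.natAbs : ℕ) : ℝ) ^ 2) * ε (x.natAbs / 2)
      ≤ 2 * ∑' j : ℕ, (1 + (j : ℝ) ^ 2) * ε (j / 2) :=
        wct_tsum_natAbs_le (u := fun j : ℕ => (1 + (j : ℝ) ^ 2) * ε (j / 2)) h0 hu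
    _ ≤ 16 * ∑' n : ℕ, (1 + (n : ℝ)) ^ 2 * ε n := by linarith

/-- The `(1+x²)`-weighted geometric factor of the majorant is summable over `ℤ`:
`Σ_x (1+x²) exp (-m (|x| - (|x|/2 + K) - R)₊) < ∞` for `m > 0` (comparison with
`e^{m(K+R)} (1+j²) e^{-m j/2}`, `j = |x|`). [folklore] -/
theorem wct_summable_weight_mul_gap {m : ℝ} (hm : 0 < m) (K R : ℕ) :
    Summable fun x : ℤ => (1 + (x : ℝ) ^ 2) *
      Real.exp (-(m * (((|x| - ((x.natAbs / 2 + K : ℕ) : ℤ) - R).toNat : ℕ) : ℝ))) := by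
  set r : ℝ := Real.exp (-(m / 2)) with hr
  have hr0 : 0 ≤ r := (Real.exp_pos _).le
  have hr1 : r < 1 := Real.exp_lt_one_iff.2 (by linarith)
  have hnorm : ‖r‖ < 1 := by rwa [Real.norm_of_nonneg hr0]
  have hgeoN : Summable fun j : ℕ => Real.exp (m * (K + R)) * ((1 + (j : ℝ) ^ 2) * r ^ j) := by
    refine Summable.mul_left _ ?_
    have h1 : Summable fun j : ℕ => r ^ j := summable_geometric_of_lt_one hr0 hr1
    have h2 : Summable fun j : ℕ => (j : ℝ) ^ 2 * r ^ j :=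
      summable_pow_mul_geometric_of_norm_lt_one 2 hnorm
    have e : (fun j : ℕ => (1 + (j : ℝ) ^ 2) * r ^ j) = fun j : ℕ => r ^ j + (j : ℝ) ^ 2 * r ^ j := by
      funext j; ring
    rw [e]
    exact h1.add h2
  have hgeoZ := wct_summable_natAbs hgeoN
  refine Summable.of_nonneg_of_le (fun x => mul_nonneg (by positivity) (Real.exp_pos _).le)
    (fun x => ?_) hgeoZ
  -- pointwise: `(1+x²) exp(-m k) ≤ exp(m(K+R)) (1+j²) r^j` since `k ≥ j/2 - K - R`, `j = |x|`
  set j : ℕ := x.natAbs with hj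
  have hxj : |x| = (j : ℤ) := by rw [hj, Int.natCast_natAbs]
  have hxsq : (x : ℝ) ^ 2 = (j : ℝ) ^ 2 := by rw [hj, Nat.cast_natAbs, Int.cast_abs, sq_abs]
  set z : ℤ := |x| - ((j / 2 + K : ℕ) : ℤ) - R with hz
  have hk : (z : ℝ) ≤ ((z.toNat : ℕ) : ℝ) := by exact_mod_cast Int.self_le_toNat z
  have hz_ge : (j : ℝ) / 2 - K - R ≤ (z : ℝ) := by
    have hdiv : ((j / 2 : ℕ) : ℝ) ≤ (j : ℝ) / 2 := Nat.cast_div_le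
    have : (z : ℝ) = (j : ℝ) - ((j / 2 : ℕ) : ℝ) - K - R := by
      rw [hz, hxj]; simp only [Int.cast_sub, Int.cast_add, Int.cast_natCast, Nat.cast_add]; ring
    rw [this]; linarith
  have hpow : r ^ j = Real.exp (-(m / 2) * j) := by
    rw [hr, ← Real.exp_nat_mul]; ring_nf
  have hexp : Real.exp (-(m * ((z.toNat : ℕ) : ℝ))) ≤ Real.exp (m * (K + R)) * r ^ j := by
    calc Real.exp (-(m * ((z.toNat : ℕ) : ℝ)))
        ≤ Real.exp (m * (K + R) + -(m / 2) * j) := Real.exp_le_exp.2 (by nlinarith)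
      _ = Real.exp (m * (K + R)) * r ^ j := by rw [hpow, Real.exp_add]
  calc (1 + (x : ℝ) ^ 2) * Real.exp (-(m * ((z.toNat : ℕ) : ℝ)))
      = (1 + (j : ℝ) ^ 2) * Real.exp (-(m * ((z.toNat : ℕ) : ℝ))) := by rw [hxsq]
    _ ≤ (1 + (j : ℝ) ^ 2) * (Real.exp (m * (K + R)) * r ^ j) :=
        mul_le_mul_of_nonneg_left hexp (by positivity)
    _ = Real.exp (m * (K + R)) * ((1 + (j : ℝ) ^ 2) * r ^ j) := by ring

/-- **STUB W2 `stub_weightedClusteringTransfer` (registered signature, verbatim): clustering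
transfer with second moments.** Under exponential ρ-mixing between half-lines (constant `C`, rate
`m > 0`) and translation invariance of a probability measure `μ` on `ChainConfig`, for a box-local
square-integrable `a` (sites in `[-R, R]`), a margin `K` and a level `Gb ≥ 0` there is `B` (namely
`B = max C 1 · ‖a‖₂ · Gb · S + 16 (max C 1 · ‖a‖₂ + ‖a‖₂)`,
`S = Σ_x (1+x²) e^{-m(|x| - (|x|/2 + K) - R)₊}`) such that for every rate `ε ≥ 0` with
`Σ_n (1+n)² ε_n < ∞` the explicit majorant
`F x = max C 1 · ‖a‖₂ (Gb + ε(|x|/2)) e^{-m(|x| - (|x|/2 + K) - R)₊} + ‖a‖₂ ε(|x|/2)` of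
`exists_summable_majorant_covariance_comp_chainShift` satisfies `Σ_x (1+x²) F x ≤ B (1 + Σ_n (1+n)² ε_n)`
and bounds `|Cov_μ(a, g ∘ τ_x)|` for every measurable `g` with `‖g‖₂ ≤ Gb` admitting
`[-(n+K), n+K]`-local approximants within `ε_n` in `L²(μ)`. [folklore] -/
theorem stub_weightedClusteringTransfer :
    ∀ μ : Measure ChainConfig, IsProbabilityMeasure μ → ∀ (C m : ℝ), 0 < m →
    (∀ (p : ℤ) (n : ℕ) (f g : ChainConfig → ℝ),
      DependsOn f {i : ℤ | i ≤ p} → DependsOn g {i : ℤ | p + n ≤ i} →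
      Measurable f → Measurable g → MemLp f 2 μ → MemLp g 2 μ →
      |MeasureTheory.integral μ (fun σ => f σ * g σ) -
          MeasureTheory.integral μ f * MeasureTheory.integral μ g| ≤
        C * Real.exp (-(m * n)) * (MeasureTheory.integral μ (fun σ => f σ ^ 2)) ^ (1 / 2 : ℝ) *
          (MeasureTheory.integral μ (fun σ => g σ ^ 2)) ^ (1 / 2 : ℝ)) →
    (∀ x : ℤ, MeasurePreserving (chainShift x) μ μ) →
    ∀ (a : ChainConfig → ℝ) (R : ℕ), DependsOn a (Set.Icc (-(R : ℤ)) R) → Measurable a → MemLp a 2 μ →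
    ∀ (K : ℕ) (Gb : ℝ), 0 ≤ Gb →
    ∃ B : ℝ, ∀ ε : ℕ → ℝ, (∀ n, 0 ≤ ε n) → Summable (fun n : ℕ => (1 + (n : ℝ)) ^ 2 * ε n) →
      ∃ F : ℤ → ℝ, Summable (fun x : ℤ => (1 + (x : ℝ) ^ 2) * F x) ∧
        (∑' x : ℤ, (1 + (x : ℝ) ^ 2) * F x) ≤ B * (1 + ∑' n : ℕ, (1 + (n : ℝ)) ^ 2 * ε n) ∧
        ∀ g : ChainConfig → ℝ, Measurable g → MemLp g 2 μ → Real.sqrt (∫ σ, g σ ^ 2 ∂μ) ≤ Gb →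
          (∀ n : ℕ, ∃ h : ChainConfig → ℝ, DependsOn h (Set.Icc (-((n + K : ℕ) : ℤ)) (n + K : ℕ)) ∧
            Measurable h ∧ MemLp h 2 μ ∧ Real.sqrt (∫ σ, (g σ - h σ) ^ 2 ∂μ) ≤ ε n) →
          ∀ x : ℤ, |ProbabilityTheory.covariance a (g ∘ chainShift x) μ| ≤ F x := by
  intro μ hμ C m hm hmix hτ a R ha ham ha2 K Gb hGb
  set A := Real.sqrt (∫ σ, a σ ^ 2 ∂μ) with hA
  have hA0 : 0 ≤ A := Real.sqrt_nonneg _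
  have hC0 : 0 ≤ max C 1 := zero_le_one.trans (le_max_right _ _)
  have hM0 : 0 ≤ max C 1 * A := mul_nonneg hC0 hA0
  -- the geometric factor of the majorant and its (`ε`-free) weighted sum
  let e : ℤ → ℝ := fun x =>
    Real.exp (-(m * (((|x| - ((x.natAbs / 2 + K : ℕ) : ℤ) - R).toNat : ℕ) : ℝ)))
  have he0 : ∀ x, 0 ≤ e x := fun x => (Real.exp_pos _).le
  have he1 : ∀ x, e x ≤ 1 := fun x => Real.exp_le_one_iff.2 (by
    have : (0 : ℝ) ≤ ((|x| - ((x.natAbs / 2 + K : ℕ) : ℤ) - R).toNat : ℕ) := Nat.cast_nonneg _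
    nlinarith)
  have hw0 : ∀ x : ℤ, 0 ≤ 1 + (x : ℝ) ^ 2 := fun x => by positivity
  have hweS : Summable fun x : ℤ => (1 + (x : ℝ) ^ 2) * e x := wct_summable_weight_mul_gap hm K R
  set Se := ∑' x : ℤ, (1 + (x : ℝ) ^ 2) * e x with hSe
  have hSe0 : 0 ≤ Se := tsum_nonneg fun x => mul_nonneg (hw0 x) (he0 x)
  refine ⟨max C 1 * A * Gb * Se + 16 * (max C 1 * A + A), fun ε hε0 hεs => ?_⟩
  obtain ⟨hwεS, hwε_le⟩ := wct_weighted_rate_int hε0 hεs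
  set E := ∑' n : ℕ, (1 + (n : ℝ)) ^ 2 * ε n with hE
  have hE0 : 0 ≤ E := tsum_nonneg fun n => mul_nonneg (sq_nonneg _) (hε0 n)
  refine ⟨fun x => max C 1 * A * (Gb + ε (x.natAbs / 2)) * e x + A * ε (x.natAbs / 2), ?_⟩
  -- domination of the weighted majorant by two summable pieces (`e ≤ 1`)
  have hdom : ∀ x : ℤ,
      (1 + (x : ℝ) ^ 2) * (max C 1 * A * (Gb + ε (x.natAbs / 2)) * e x + A * ε (x.natAbs / 2)) ≤
        max C 1 * A * Gb * ((1 + (x : ℝ) ^ 2) * e x) +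
          (max C 1 * A + A) * ((1 + (x : ℝ) ^ 2) * ε (x.natAbs / 2)) := by
    intro x
    have h1 : ε (x.natAbs / 2) * e x ≤ ε (x.natAbs / 2) := by
      simpa only [mul_one] using mul_le_mul_of_nonneg_left (he1 x) (hε0 (x.natAbs / 2))
    have h2 := mul_le_mul_of_nonneg_left h1 (mul_nonneg hM0 (hw0 x))
    linarith [h2]
  have hHS : Summable fun x : ℤ => max C 1 * A * Gb * ((1 + (x : ℝ) ^ 2) * e x) +
      (max C 1 * A + A) * ((1 + (x : ℝ) ^ 2) * ε (x.natAbs / 2)) :=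
    (hweS.mul_left _).add (hwεS.mul_left _)
  have hF0 : ∀ x : ℤ,
      0 ≤ (1 + (x : ℝ) ^ 2) * (max C 1 * A * (Gb + ε (x.natAbs / 2)) * e x + A * ε (x.natAbs / 2)) :=
    fun x => mul_nonneg (hw0 x) (add_nonneg
      (mul_nonneg (mul_nonneg hM0 (add_nonneg hGb (hε0 _))) (he0 x)) (mul_nonneg hA0 (hε0 _)))
  have hFS : Summable fun x : ℤ =>
      (1 + (x : ℝ) ^ 2) * (max C 1 * A * (Gb + ε (x.natAbs / 2)) * e x + A * ε (x.natAbs / 2)) :=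
    Summable.of_nonneg_of_le hF0 hdom hHS
  refine ⟨hFS, ?_, ?_⟩
  · -- the weighted sum of the majorant
    calc ∑' x : ℤ, (1 + (x : ℝ) ^ 2) *
          (max C 1 * A * (Gb + ε (x.natAbs / 2)) * e x + A * ε (x.natAbs / 2))
        ≤ ∑' x : ℤ, (max C 1 * A * Gb * ((1 + (x : ℝ) ^ 2) * e x) +
            (max C 1 * A + A) * ((1 + (x : ℝ) ^ 2) * ε (x.natAbs / 2))) :=
          hFS.tsum_le_tsum hdom hHS
      _ = max C 1 * A * Gb * Se +
            (max C 1 * A + A) * ∑' x : ℤ, (1 + (x : ℝ) ^ 2) * ε (x.natAbs / 2) := by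
          rw [(hweS.mul_left _).tsum_add (hwεS.mul_left _), tsum_mul_left, tsum_mul_left]
      _ ≤ max C 1 * A * Gb * Se + (max C 1 * A + A) * (16 * E) := by
          have := mul_le_mul_of_nonneg_left hwε_le (add_nonneg hM0 hA0)
          linarith
      _ ≤ (max C 1 * A * Gb * Se + 16 * (max C 1 * A + A)) * (1 + E) := by
          have h1 : 0 ≤ max C 1 * A * Gb * Se * E :=
            mul_nonneg (mul_nonneg (mul_nonneg hM0 hGb) hSe0) hE0
          nlinarith [h1, add_nonneg hM0 hA0]
  · -- the pointwise bound, verbatim the tree proof of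
    -- `exists_summable_majorant_covariance_comp_chainShift`
    intro g _hgm hg2 hgG hloc x
    obtain ⟨h, hhdep, hhm, hh2, hherr⟩ := hloc (x.natAbs / 2)
    have hgx2 : MemLp (g ∘ chainShift x) 2 μ := hg2.comp_measurePreserving (hτ x)
    have hhx2 : MemLp (h ∘ chainShift x) 2 μ := hh2.comp_measurePreserving (hτ x)
    have hsub2 : MemLp (fun σ => g σ - h σ) 2 μ := hg2.sub hh2
    have hsubx2 : MemLp ((fun σ => g σ - h σ) ∘ chainShift x) 2 μ :=
      hsub2.comp_measurePreserving (hτ x)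
    show |cov[a, g ∘ chainShift x; μ]| ≤
      max C 1 * A * (Gb + ε (x.natAbs / 2)) * e x + A * ε (x.natAbs / 2)
    -- split `g = h + (g - h)` behind the translation
    rw [covariance_comp_eq_add_sub ha2 hgx2 hhx2]
    refine (abs_add_le _ _).trans (add_le_add ?_ ?_)
    · -- the local part, by the box form of mixing
      have hloc_le :=
        abs_covariance_comp_chainShift_le_of_mixing hmix hτ ha ham ha2 hhdep hhm hh2 x
      have hB : Real.sqrt (∫ σ, h σ ^ 2 ∂μ) ≤ Gb + ε (x.natAbs / 2) :=
        (sqrt_integral_sq_le_add_sqrt_integral_sub_sq hg2 hh2).trans (add_le_add hgG hherr)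
      refine hloc_le.trans ?_
      have : max C 1 * e x * A * Real.sqrt (∫ σ, h σ ^ 2 ∂μ) ≤
          max C 1 * e x * A * (Gb + ε (x.natAbs / 2)) :=
        mul_le_mul_of_nonneg_left hB (mul_nonneg (mul_nonneg hC0 (he0 x)) hA0)
      calc max C 1 *
            Real.exp (-(m * (((|x| - ((x.natAbs / 2 + K : ℕ) : ℤ) - R).toNat : ℕ) : ℝ))) * A *
            Real.sqrt (∫ σ, h σ ^ 2 ∂μ)
          = max C 1 * e x * A * Real.sqrt (∫ σ, h σ ^ 2 ∂μ) := rfl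
        _ ≤ max C 1 * e x * A * (Gb + ε (x.natAbs / 2)) := this
        _ = max C 1 * A * (Gb + ε (x.natAbs / 2)) * e x := by ring
    · -- the remainder, by Cauchy–Schwarz and translation invariance
      refine (abs_covariance_le_sqrt_integral_sq_mul ha2 hsubx2).trans ?_
      rw [integral_sq_comp_chainShift (hτ x) hsub2.aestronglyMeasurable]
      exact mul_le_mul_of_nonneg_left hherr hA0

end Summit.AtomisticToContinuum.FouriersLaw.Theorems.FibreCalculusSketch

end
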